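import Literature.AlgebraicGeometry.CossartPiltant200819.Projective2019
import Literature.AlgebraicGeometry.Resolution.GeneralLUProofs
import Literature.AlgebraicGeometry.Resolution.DimensionInequalityTrdeg
import Literature.AlgebraicGeometry.Resolution.PrincipalizationToResolution
import Literature.AlgebraicGeometry.Motives.IntegralProjectiveSpace
import Literature.AlgebraicGeometry.Motives.GenericFibre
import Literature.AlgebraicGeometry.Motives.SmoothSpread
import Literature.AlgebraicGeometry.Motives.CyclesDimensionFunctionField
import Literature.AlgebraicGeometry.Morphisms.IsoOverOpen
import Literature.RingTheory.KrullDimension.AffineDimension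
import Mathlib.AlgebraicGeometry.Morphisms.SchemeTheoreticallyDominant
import Mathlib.RingTheory.Flat.TorsionFree
import HarnessLib

/-!
# Cossart–Piltant 2019, Corollary 1.3 from Theorem 1.1 (projective regular surfaces over Dedekind domains have proper flat regular models)

Topic: `Literature/AlgebraicGeometry/CossartPiltant200819`. V. Cossart, O. Piltant, *Resolution of
singularities of arithmetical threefolds*, J. Algebra 529 (2019) 268–535 (arXiv:1412.0868),
Corollary 1.3 (verbatim, §1): "Let `𝒪` be an excellent Dedekind domain with quotient field `F`
and `Σ/F` be a regular projective surface. There exists a proper and flat `𝒪`-scheme `𝒳` with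
generic fiber `𝒳_F = Σ` which is everywhere regular." Its printed proof (§4.1, right after the
proof of Thm. 1.1; arXiv:1412.0868v1 p. 52, verbatim): "let `𝒴` be any projective `𝒪`-scheme
with generic fiber `𝒴_F = Σ`, e.g. clearing denominators in `Σ`. By generic flatness
[EGA IV₂ (6.9.1), Publ. IHES 24], there exists `𝒰 ⊆ Spec 𝒪` such that `s⁻¹(𝒰)` is flat over `𝒰`. Apply
theorem 1.1 to the Zariski closure of `s⁻¹(𝒰)` in `𝒴`, where `s : 𝒴 → Spec 𝒪` is the structure
morphism." (and §1, before the statement: "Since the class of quasi-excellent schemes is stable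
by morphisms of finite type, theorem 1.1 applies in particular to algebraic varieties and to
arithmetical varieties over excellent Dedekind ring.") The derivation formalised here is this
proof in the variant — the formaliser's, not the paper's wording — for an INTEGRAL `Σ` (the
tree's `CossartPiltant2019Cor13` writes `S` for `Σ` and asks `S` integral, i.e. one irreducible
regular surface at a time), where generic flatness is not needed: embed
`Σ ⊆ ℙᴺ_F = ℙᴺ_𝒪 ×_𝒪 F` and take for `𝒴 ⊆ ℙᴺ_𝒪` the scheme-theoretic closure of `Σ` ("clearing
denominators"); it is an integral projective `𝒪`-scheme of dimension `≤ 3` (an "arithmetical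
threefold") with generic fibre `Σ`, reduced, separated, Noetherian and quasi-excellent (finite
type over the excellent ring `𝒪`, [Stacks 07QU]); Theorem 1.1 gives `π : 𝒳 → 𝒴` proper
birational with `𝒳` regular and `π` an isomorphism over `Reg 𝒴 ⊇ Σ`; then `𝒳 → Spec 𝒪` is
proper, flat (an integral scheme dominating a Dedekind scheme is flat — this replaces the
generic-flatness step) with generic fibre `𝒳_F = 𝒴_F = Σ`.

This file DERIVES the tree's named fact `CP2019.CossartPiltant2019Cor13` (`Projective2019.lean`)
from the tree's transcription of Theorem 1.1, `CP2019.CossartPiltant2019Thm11`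
(`GoodResolution2019.lean`): `CP2019.cor13_of_thm11 : CossartPiltant2019Thm11 →
CossartPiltant2019Cor13`. Everything else is proved here over Mathlib and the tree:

* `isDominant_of_apply_eq_bot`, `appLE_injective_of_isDominant` — a morphism to `Spec R`
  (`R` a domain) hitting the generic point is dominant; for `Z` integral and `Z → Spec R`
  dominant, `R = Γ(Spec R) → Γ(Z, V)` is injective for every non-empty open `V`;
* `flat_of_isIntegral_of_isDominant` — **an integral scheme dominating the spectrum of a
  Dedekind domain is flat over it** (flat = torsion-free over Dedekind domains, Mathlib
  `IsDedekindDomain.flat_iff_torsion_eq_bot`; Hartshorne III.9.7);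
* `isIso_pullback_snd_of_range_subset` — if `π` is an isomorphism over `U` and `j : T → X` lands
  in `U` then `X' ×_X T → T` is an isomorphism;
* `topologicalKrullDim_le_of_genericFibre` — **dimension of a model**: for `𝒴` integral, locally
  of finite type over a Dedekind domain `𝒪`, and `j : T → 𝒴` schematically dominant, affine and
  quasi-compact with `T` integral of dimension `n`, locally of finite type over `F = Frac 𝒪` and
  `j ≫ (𝒴 → Spec 𝒪) = (T → Spec F) ≫ (Spec F → Spec 𝒪)`, one has `dim 𝒴 ≤ n + 1` — by the
  dimension inequality `ht P ≤ ht (P ∩ 𝒪) + tr.deg_𝒪 Γ(𝒴, U)`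
  (`Resolution.height_le_height_add_trdeg`, Matsumura Thm. 15.5), `ht ≤ 1` in `𝒪`, and
  `tr.deg_𝒪 Γ(𝒴, U) ≤ tr.deg_F Γ(T, j⁻¹U) = dim T` (Mathlib `trdeg_le_of_injective`,
  `trdeg_add_eq`; the tree's `Motives.height_top_eq_ringKrullDim` and
  `RingTheory.KrullDimension.ringKrullDim_eq_trdeg`);
* `exists_regularModel_of_thm11` — the regular proper flat model with generic fibre `S`, for an
  integral regular projective `F`-scheme `S` of ANY dimension `d ≤ 2` (so that it also serves the
  irreducible components — surfaces, curves or points — of a non-connected regular surface), by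
  the derivation above, the model being built exactly as in the tree's
  `Motives.exists_finite_forall_exists_integralModel` (`GoodReductionProofs.lean`:
  `ProjBaseChangeRing.isPullback_projMap`, `Motives.isPullback_toImage_of_flat_mono`);
* `cor13_of_thm11` — the corollary (`d = 2`).

## References

* V. Cossart, O. Piltant, J. Algebra 529 (2019) 268–535, Thm. 1.1, Cor. 1.3. [CossartPiltant2019]
* H. Matsumura, *Commutative Ring Theory*, Thm. 15.5. [Matsumura1987]
* R. Hartshorne, *Algebraic Geometry*, III Prop. 9.7. [Hartshorne1977]
-/

noncomputable section

open CategoryTheory CategoryTheory.Limits AlgebraicGeometry TopologicalSpace Order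

namespace Literature.AlgebraicGeometry.CossartPiltant200819.CP2019

open Literature.AlgebraicGeometry.Resolution Literature.AlgebraicGeometry.Motives
  Literature.AlgebraicGeometry.Morphisms

universe u

/-! ## Dominant morphisms to the spectrum of a domain -/

section Dominant

variable {R : Type u} [CommRing R] [IsDomain R] {Z : Scheme.{u}} (g : Z ⟶ Spec (.of R))

/-- A morphism to `Spec R`, `R` a domain, whose image contains the generic point `(0)` is
dominant. [folklore] -/
theorem isDominant_of_apply_eq_bot (z : Z)
    (hz : g z = (⟨⊥, Ideal.isPrime_bot⟩ : PrimeSpectrum R)) : IsDominant g := by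
  constructor
  rw [DenseRange, dense_iff_closure_eq]
  refine Set.eq_univ_of_forall fun x => ?_
  have hspec : (⟨⊥, Ideal.isPrime_bot⟩ : PrimeSpectrum R) ⤳ x :=
    (PrimeSpectrum.le_iff_specializes _ _).mp bot_le
  have hx : x ∈ closure {(⟨⊥, Ideal.isPrime_bot⟩ : PrimeSpectrum R)} :=
    specializes_iff_mem_closure.mp hspec
  have hzr : (⟨⊥, Ideal.isPrime_bot⟩ : PrimeSpectrum R) ∈ Set.range g := Set.mem_range.mpr ⟨z, hz⟩
  exact closure_mono (Set.singleton_subset_iff.mpr hzr) hx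

/-- Every point of `Spec K` (`K ⊇ R` the fraction field) maps to the generic point of `Spec R`.
[folklore] -/
theorem specMap_algebraMap_apply_eq_bot (K : Type u) [Field K] [Algebra R K] [IsFractionRing R K]
    (p : Spec (.of K)) :
    Spec.map (CommRingCat.ofHom (algebraMap R K)) p = (⟨⊥, Ideal.isPrime_bot⟩ : PrimeSpectrum R) := by
  have hp : p = (⟨⊥, Ideal.isPrime_bot⟩ : PrimeSpectrum K) := Subsingleton.elim _ _
  subst hp
  rw [Spec.map_apply]
  exact PrimeSpectrum.ext (Ideal.comap_bot_of_injective _ (IsFractionRing.injective R K))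

/-- Restriction of sections of an integral scheme to a non-empty open is injective. [folklore] -/
theorem presheaf_map_injective_of_isIntegral [IsIntegral Z] {U V : Z.Opens} (i : V ≤ U)
    [hV : Nonempty V] : Function.Injective (Z.presheaf.map (homOfLE i).op) := by
  obtain ⟨⟨x, hx⟩⟩ := hV
  intro a b hab
  apply germ_injective_of_isIntegral Z (U := U) x (i hx)
  have ha := TopCat.Presheaf.germ_res_apply Z.presheaf (homOfLE i) x hx a
  have hb := TopCat.Presheaf.germ_res_apply Z.presheaf (homOfLE i) x hx b
  rw [← ha, ← hb]
  exact congrArg _ hab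

/-- **For `Z` integral and `g : Z → Spec R` dominant and quasi-compact, `Γ(Spec R) → Γ(Z, V)` is
injective for every non-empty open `V`** (`𝒪_{Spec R} → g_* 𝒪_Z` is injective, Mathlib
`Scheme.Hom.app_injective`, and restrictions on an integral scheme are injective). [folklore] -/
theorem appLE_injective_of_isDominant [IsIntegral Z] [IsDominant g] [QuasiCompact g]
    (V : Z.Opens) [Nonempty V] : Function.Injective (g.appLE ⊤ V le_top) := by
  haveI : IsSchemeTheoreticallyDominant g := IsSchemeTheoreticallyDominant.of_isDominant g
  intro a b hab
  exact g.app_injective ⊤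
    (presheaf_map_injective_of_isIntegral (Z := Z) (U := g ⁻¹ᵁ ⊤) (V := V) le_top hab)

end Dominant

/-! ## Integral schemes over Dedekind domains are flat -/

section FlatDedekind

variable {R : Type u} [CommRing R] [IsDedekindDomain R] {Z : Scheme.{u}} (g : Z ⟶ Spec (.of R))

/-- **An integral scheme dominating the spectrum of a Dedekind domain is flat over it** (flat =
torsion-free over Dedekind domains, Mathlib `IsDedekindDomain.flat_iff_torsion_eq_bot`; the rings
of functions of the non-empty affine opens of `Z` are domains into which `R` injects; Hartshorne
III Prop. 9.7). [cite: Hartshorne1977, III Prop. 9.7 p. 257] -/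
theorem flat_of_isIntegral_of_isDominant [IsIntegral Z] [IsDominant g] [QuasiCompact g] :
    Flat g := by
  apply HasRingHomProperty.of_iSup_eq_top (P := @Flat) (fun V : Z.affineOpens => V)
    (iSup_affineOpens_eq_top Z)
  intro V
  set φ := (g.appLE ⊤ (V : Z.Opens) le_top).hom with hφ
  let eR : R ≃+* Γ(Spec (.of R), ⊤) := (Scheme.ΓSpecIso (.of R)).symm.commRingCatIsoToRingEquiv
  change φ.Flat
  rw [← RingHom.Flat.comp_iff_of_bijective_right (f := φ) (g := eR.toRingHom) eR.bijective]
  letI := (φ.comp eR.toRingHom).toAlgebra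
  change Module.Flat R Γ(Z, V)
  rw [IsDedekindDomain.flat_iff_torsion_eq_bot, ← Submodule.isTorsionFree_iff_torsion_eq_bot]
  -- empty `V`: nothing to prove
  rcases isEmpty_or_nonempty (V : Z.Opens) with hV | hV
  · have hbot : (V : Z.Opens) = ⊥ := by
      ext x
      exact ⟨fun hx => (hV.false ⟨x, hx⟩).elim, fun hx => hx.elim⟩
    haveI : Subsingleton Γ(Z, V) :=
      CommRingCat.subsingleton_of_isTerminal (Z.sheaf.isTerminalOfEqEmpty hbot)
    infer_instance
  -- non-empty `V`: `Γ(Z, V)` is a domain and `φ` is injective (`Z → Spec R` is dominant)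
  haveI : IsDomain Γ(Z, V) := inferInstance
  have hinj : Function.Injective (φ.comp eR.toRingHom) :=
    (appLE_injective_of_isDominant g V).comp eR.injective
  haveI : FaithfulSMul R Γ(Z, V) := (faithfulSMul_iff_algebraMap_injective _ _).mpr hinj
  infer_instance

end FlatDedekind

/-! ## Isomorphisms over an open and base change into the open -/

/-- If `π : X' → X` is an isomorphism over the open `U ⊆ X` and `j : T → X` has image in `U`, then
the base change `X' ×_X T → T` is an isomorphism. [folklore] -/
theorem isIso_pullback_snd_of_range_subset {X' X T : Scheme.{u}} (π : X' ⟶ X) (U : X.Opens)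
    [IsIso (π ∣_ U)] (j : T ⟶ X) (hj : Set.range j ⊆ (U : Set X)) : IsIso (pullback.snd π j) := by
  have hU : j ⁻¹ᵁ U = ⊤ := by
    ext σ
    simpa using hj ⟨σ, rfl⟩
  haveI h := isIso_morphismRestrict_pullback_snd π j U
  have h' : (MorphismProperty.isomorphisms Scheme.{u}) (pullback.snd π j) := by
    apply IsZariskiLocalAtTarget.of_iSup_eq_top (P := MorphismProperty.isomorphisms Scheme.{u})
      (fun _ : Unit => j ⁻¹ᵁ U) (by rw [hU]; exact ciSup_const)
    intro _
    exact (MorphismProperty.isomorphisms.iff _).mpr h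
  exact (MorphismProperty.isomorphisms.iff _).mp h'

/-! ## The dimension of a model from the dimension of its generic fibre -/

section ModelDimension

variable {O F : Type u} [CommRing O] [IsDedekindDomain O] [Field F] [Algebra O F]
  [IsFractionRing O F] {Y T : Scheme.{u}} [IsIntegral Y] [IsIntegral T]
  (f : Y ⟶ Spec (.of O)) [LocallyOfFiniteType f] [QuasiCompact f]
  (a : T ⟶ Spec (.of F)) [LocallyOfFiniteType a]
  (j : T ⟶ Y) [IsSchemeTheoreticallyDominant j] [QuasiCompact j] [IsAffineHom j]

/-- **Dimension of a model over a Dedekind domain** (the step "`𝒴` is an arithmetical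
threefold" of the proof of Cor. 1.3): if `𝒴` is integral, locally of finite type over the Dedekind
domain `𝒪`, and `j : T → 𝒴` is schematically dominant, affine and quasi-compact, with `T`
integral of dimension `n`, locally of finite type over `F = Frac 𝒪`, and
`j ≫ (𝒴 → Spec 𝒪) = (T → Spec F) ≫ (Spec F → Spec 𝒪)`, then `dim 𝒴 ≤ n + 1`. Proof: for
`y ∈ 𝒴` in an affine open `U = Spec B`, `codim y = ht 𝔭_y ≤ ht (𝔭_y ∩ 𝒪) + tr.deg_𝒪 B`
(Matsumura Thm. 15.5, `Resolution.height_le_height_add_trdeg`), `ht (𝔭_y ∩ 𝒪) ≤ dim 𝒪 ≤ 1`, and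
`tr.deg_𝒪 B ≤ tr.deg_𝒪 Γ(T, j⁻¹U) = tr.deg_F Γ(T, j⁻¹U) = dim T = n` (`B ↪ Γ(T, j⁻¹U)`,
`tr.deg_𝒪 F = 0`). [cite: Matsumura1987, Thm. 15.5] -/
theorem topologicalKrullDim_le_of_genericFibre
    (hsq : j ≫ f = a ≫ Spec.map (CommRingCat.ofHom (algebraMap O F))) {n : ℕ}
    (hT : topologicalKrullDim T = n) : topologicalKrullDim Y ≤ (n + 1 : ℕ) := by
  classical
  set i : Spec (.of F) ⟶ Spec (.of O) := Spec.map (CommRingCat.ofHom (algebraMap O F)) with hi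
  -- `f` is dominant: `T ≠ ∅` maps to the generic point of `Spec 𝒪`
  obtain ⟨σ₀⟩ := (inferInstance : Nonempty T)
  haveI : IsDominant f := by
    refine isDominant_of_apply_eq_bot f (j σ₀) ?_
    rw [← Scheme.Hom.comp_apply, hsq, Scheme.Hom.comp_apply]
    exact specMap_algebraMap_apply_eq_bot F (a σ₀)
  rw [topologicalKrullDim_le_iff_forall_coheight_le]
  intro y
  -- an affine open `U = Spec B ∋ y`
  obtain ⟨_, ⟨U, hU, rfl⟩, hyU, -⟩ :=
    Y.isBasis_affineOpens.exists_subset_of_mem_open (Set.mem_univ y) isOpen_univ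
  have hU : IsAffineOpen U := hU
  haveI : Nonempty U := ⟨⟨y, hyU⟩⟩
  -- `codim y = ht 𝔭_y`
  set P : Spec Γ(Y, U) := hU.isoSpec.hom ⟨y, hyU⟩ with hP
  have hco : coheight y = P.asIdeal.height := by
    have h1 := coheight_eq_of_isOpenImmersion (U := U) (X := Y) (x := ⟨y, hyU⟩) (Scheme.Opens.ι U)
    have h2 := coheight_eq_of_isOpenImmersion (U := U) (X := Spec Γ(Y, U)) (x := ⟨y, hyU⟩)
      hU.isoSpec.hom
    rw [idealHeight_eq_coheight, hP, h2, ← h1]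
    rfl
  -- `B = Γ(Y, U)` as an `𝒪`-algebra: a finitely generated domain into which `𝒪` injects
  let eO : O ≃+* Γ(Spec (.of O), ⊤) := (Scheme.ΓSpecIso (.of O)).symm.commRingCatIsoToRingEquiv
  let φ : O →+* Γ(Y, U) := (f.appLE ⊤ U le_top).hom.comp eO.toRingHom
  letI algOB : Algebra O Γ(Y, U) := φ.toAlgebra
  haveI : Algebra.FiniteType O Γ(Y, U) := by
    have h1 : (f.appLE ⊤ U le_top).hom.FiniteType :=
      f.finiteType_appLE (isAffineOpen_top _) hU le_top
    have h2 : eO.toRingHom.FiniteType := RingHom.FiniteType.of_surjective _ eO.surjective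
    exact h1.comp h2
  haveI : IsDomain Γ(Y, U) := inferInstance
  have hφinj : Function.Injective φ := (appLE_injective_of_isDominant f U).comp eO.injective
  haveI : FaithfulSMul O Γ(Y, U) := (faithfulSMul_iff_algebraMap_injective _ _).mpr hφinj
  -- the dimension inequality: `ht 𝔭_y ≤ ht (𝔭_y ∩ 𝒪) + tr.deg_𝒪 B`
  have hineq := height_le_height_add_trdeg (P.asIdeal.under O) P.asIdeal
  -- `ht (𝔭_y ∩ 𝒪) ≤ 1`
  have hht1 : (P.asIdeal.under O).height ≤ 1 := by
    have h := (Ideal.height_le_ringKrullDim_of_isPrime (I := P.asIdeal.under O)).trans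
      (Ring.krullDimLE_iff.mp (inferInstance : Ring.KrullDimLE 1 O))
    exact_mod_cast h
  -- `V = j⁻¹ U = Spec B'`, a non-empty affine open of `T`, and `B ↪ B'`
  set V : T.Opens := j ⁻¹ᵁ U with hV
  have hVaff : IsAffineOpen V := hU.preimage j
  obtain ⟨σ, hσ⟩ : ∃ σ : T, j σ ∈ U := j.denseRange.exists_mem_open U.isOpen ⟨y, hyU⟩
  haveI : Nonempty V := ⟨⟨σ, hσ⟩⟩
  haveI : IsDomain Γ(T, V) := inferInstance
  let ψ : Γ(Y, U) →+* Γ(T, V) := (j.app U).hom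
  have hψinj : Function.Injective ψ := j.app_injective U
  letI algOB' : Algebra O Γ(T, V) := (ψ.comp φ).toAlgebra
  letI algBB' : Algebra Γ(Y, U) Γ(T, V) := ψ.toAlgebra
  haveI : IsScalarTower O Γ(Y, U) Γ(T, V) := IsScalarTower.of_algebraMap_eq fun _ => rfl
  have htr1 : Algebra.trdeg O Γ(Y, U) ≤ Algebra.trdeg O Γ(T, V) :=
    trdeg_le_of_injective (⟨⟨⟨⟨ψ, map_one ψ⟩, map_mul ψ⟩, map_zero ψ, map_add ψ⟩, fun _ => rfl⟩ :
      Γ(Y, U) →ₐ[O] Γ(T, V)) hψinj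
  -- `B'` as an `F`-algebra, and the tower `𝒪 → F → B'`
  let eF : F ≃+* Γ(Spec (.of F), ⊤) := (Scheme.ΓSpecIso (.of F)).symm.commRingCatIsoToRingEquiv
  let χ : F →+* Γ(T, V) := (a.appLE ⊤ V le_top).hom.comp eF.toRingHom
  letI algFB' : Algebra F Γ(T, V) := χ.toAlgebra
  haveI : Algebra.FiniteType F Γ(T, V) := by
    have h1 : (a.appLE ⊤ V le_top).hom.FiniteType :=
      a.finiteType_appLE (isAffineOpen_top _) hVaff le_top
    have h2 : eF.toRingHom.FiniteType := RingHom.FiniteType.of_surjective _ eF.surjective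
    exact h1.comp h2
  haveI : FaithfulSMul F Γ(T, V) :=
    (faithfulSMul_iff_algebraMap_injective _ _).mpr (algebraMap F Γ(T, V)).injective
  have hcomm : (Scheme.ΓSpecIso (.of O)).inv ≫ f.appLE ⊤ U le_top ≫ j.app U =
      CommRingCat.ofHom (algebraMap O F) ≫ (Scheme.ΓSpecIso (.of F)).inv ≫ a.appLE ⊤ V le_top := by
    have h1 : f.appLE ⊤ U le_top ≫ j.app U = (j ≫ f).appLE ⊤ V le_top := by
      rw [Scheme.Hom.app_eq_appLE, Scheme.Hom.appLE_comp_appLE]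
    have h2 : (j ≫ f).appLE ⊤ V le_top = (a ≫ i).appLE ⊤ V le_top := by rw [hsq]
    have h3 : (a ≫ i).appLE ⊤ V le_top = i.appTop ≫ a.appLE ⊤ V le_top := by
      show _ = i.app ⊤ ≫ a.appLE ⊤ V le_top
      simp only [Scheme.Hom.appLE, Scheme.Hom.comp_app]
      rfl
    rw [h1, h2, h3, hi, ← Scheme.ΓSpecIso_inv_naturality_assoc]
  haveI : IsScalarTower O F Γ(T, V) := by
    refine IsScalarTower.of_algebraMap_eq fun r => ?_
    exact congrArg (fun t => t.hom r) hcomm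
  haveI : Algebra.IsAlgebraic O F := IsLocalization.isAlgebraic F (nonZeroDivisors O)
  have htr2 : Algebra.trdeg O Γ(T, V) = Algebra.trdeg F Γ(T, V) := by
    rw [← trdeg_add_eq O F (A := Γ(T, V)), trdeg_eq_zero (R := O) (A := F), zero_add]
  -- `tr.deg_F B' = dim T = n`
  have htr3 : Cardinal.toNat (Algebra.trdeg F Γ(T, V)) = n := by
    have h1 := height_top_eq_ringKrullDim a hVaff
    rw [Literature.RingTheory.KrullDimension.ringKrullDim_eq_trdeg F Γ(T, V),
      Order.height_top_eq_krullDim, ← topologicalKrullDim_eq_krullDim_carrier, hT] at h1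
    exact_mod_cast h1.symm
  have hfin : Algebra.trdeg O Γ(T, V) < Cardinal.aleph0 := by
    rw [htr2]; exact trdeg_lt_aleph0
  have htr : Cardinal.toNat (Algebra.trdeg O Γ(Y, U)) ≤ n := by
    rw [← htr3, ← htr2]
    exact Cardinal.toNat_le_toNat htr1 hfin
  -- assemble
  rw [hco]
  calc P.asIdeal.height ≤ (P.asIdeal.under O).height + Cardinal.toNat (Algebra.trdeg O Γ(Y, U)) :=
        hineq
    _ ≤ 1 + (n : ℕ∞) := add_le_add hht1 (by exact_mod_cast htr)
    _ = (n + 1 : ℕ) := by rw [add_comm]; norm_cast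

end ModelDimension

/-! ## Corollary 1.3 from Theorem 1.1 -/

section Cor13

attribute [local instance] MvPolynomial.gradedAlgebra
  Literature.AlgebraicGeometry.Motives.ProjBaseChange.algebraBase

/-- **The regular model, for an integral regular projective `F`-scheme of dimension `d ≤ 2`**
(the construction behind Cor. 1.3, stated for all `d ≤ 2` so that it also serves the
irreducible components of a non-connected regular surface, which may be curves or points):
given the tree's transcription `CossartPiltant2019Thm11` of Theorem 1.1, an excellent Dedekind
domain `𝒪` with fraction field `F` and an integral regular projective `F`-scheme `S` with
`dim S = d ≤ 2`, there is a proper flat `𝒪`-scheme `𝒳`, everywhere regular, with generic fibre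
`𝒳 ×_𝒪 F ≅ S` over `F`. Proof: the scheme-theoretic closure `𝒴` of `S ⊆ ℙᴺ_F` in `ℙᴺ_𝒪`
is an integral, separated, Noetherian, quasi-excellent (`Resolution.Stacks07QU_holds`) scheme of
dimension `≤ d + 1 ≤ 3` (`topologicalKrullDim_le_of_genericFibre`) with generic fibre `S`
(`Motives.isPullback_toImage_of_flat_mono`); Theorem 1.1 resolves it by `π : 𝒳 → 𝒴`, an
isomorphism over `Reg 𝒴 ⊇ S`; `𝒳 → Spec 𝒪` is proper, flat (`flat_of_isIntegral_of_isDominant`)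
and regular with generic fibre `𝒳 ×_𝒪 F = 𝒳 ×_𝒴 (𝒴 ×_𝒪 F) = 𝒳 ×_𝒴 S ≅ S`.
[cite: CossartPiltant2019, Cor. 1.3 (statement §1, arXiv:1412.0868v1 p. 3; proof §4.1, p. 52)] -/
theorem exists_regularModel_of_thm11 (h : CossartPiltant2019Thm11.{u})
    (O : Type u) [CommRing O] [IsDedekindDomain O] (hO : IsExcellentRing O)
    (F : Type u) [Field F] [Algebra O F] [IsFractionRing O F] (S : SchemeOver F)
    (hS : IsProjectiveOver S) [IsIntegral S.left] (hreg : Scheme.IsRegular S.left)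
    {d : ℕ} (hdim : topologicalKrullDim S.left = d) (hd : d ≤ 2) :
    ∃ (𝒳 : Scheme.{u}) (g : 𝒳 ⟶ Spec (.of O)), IsProper g ∧ Flat g ∧ Scheme.IsRegular 𝒳 ∧
      Nonempty (Over.mk (pullback.snd g (Spec.map (CommRingCat.ofHom (algebraMap O F)))) ≅ S) := by
  classical
  haveI : Module.Flat O F := IsLocalization.flat F (nonZeroDivisors O)
  obtain ⟨N, ι, hι⟩ := hS
  haveI : @IsClosedImmersion S.left (Proj (MvPolynomial.homogeneousSubmodule (Fin (N + 1)) F))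
      ι.left := hι
  -- the base change `Spec F → Spec 𝒪`
  set i : Spec (.of F) ⟶ Spec (.of O) := Spec.map (CommRingCat.ofHom (algebraMap O F)) with hi
  haveI : Flat i := Motives.flat_specMap_of_isLocalization O F (nonZeroDivisors O)
  haveI : Mono i := Motives.mono_specMap_of_isLocalization O F (nonZeroDivisors O)
  haveI : SurjectiveOnStalks i := SurjectiveOnStalks.Spec_iff.mpr
    (RingHom.surjectiveOnStalks_of_isLocalization (M := nonZeroDivisors O) F)
  -- projective spaces over `𝒪` and `F`
  set pO := ProjBaseChangeRing.projToSpec (Fin (N + 1)) O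
  set pF := ProjBaseChangeRing.projToSpec (Fin (N + 1)) F
  set φ := Proj.map (ProjBaseChangeRing.mapGraded O F (Fin (N + 1)))
    (ProjBaseChangeRing.irrelevant_le_map O F (Fin (N + 1)))
  have hP : IsPullback φ pF pO i := ProjBaseChangeRing.isPullback_projMap O F (Fin (N + 1))
  haveI hφqc : QuasiCompact φ := MorphismProperty.of_isPullback hP.flip inferInstance
  have hιw : ι.left ≫ pF = S.hom := Over.w ι
  haveI : IsProper pF := ProjBaseChangeRing.isProper_projToSpec (Fin (N + 1)) F
  have hιft : @LocallyOfFiniteType S.left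
      (Proj (MvPolynomial.homogeneousSubmodule (Fin (N + 1)) F)) ι.left := inferInstance
  have hιqc : @QuasiCompact S.left
      (Proj (MvPolynomial.homogeneousSubmodule (Fin (N + 1)) F)) ι.left := inferInstance
  haveI hpFft : LocallyOfFiniteType pF := IsProper.toLocallyOfFiniteType
  haveI : LocallyOfFiniteType S.hom := by
    rw [← hιw]; exact AlgebraicGeometry.locallyOfFiniteType_comp (hf := hιft) (hg := hpFft)
  -- the model `𝒴`: the scheme-theoretic image of `S → ℙᴺ_F → ℙᴺ_𝒪`, with generic fibre `S`
  set g := ι.left ≫ φ with hg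
  haveI : QuasiCompact g := by
    rw [hg]; exact @AlgebraicGeometry.quasiCompact_comp _ _ _ ι.left φ hιqc hφqc
  set f : g.image ⟶ Spec (.of O) := g.imageι ≫ pO
  have Hgen : IsPullback g.toImage S.hom f i :=
    Motives.isPullback_toImage_of_flat_mono i pO pF φ hP _ S.hom hιw
  haveI : IsProper pO := ProjBaseChangeRing.isProper_projToSpec (Fin (N + 1)) O
  haveI : IsProper f := inferInstance
  -- `j = (S → 𝒴)` is a schematically dominant, affine, quasi-compact, flat base change of `i`
  set j := g.toImage with hj
  haveI : IsSchemeTheoreticallyDominant j := Motives.isSchemeTheoreticallyDominant_toImage g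
  haveI : IsAffineHom j := MorphismProperty.of_isPullback Hgen.flip inferInstance
  haveI : QuasiCompact j := MorphismProperty.of_isPullback Hgen.flip inferInstance
  haveI : Flat j := MorphismProperty.of_isPullback Hgen.flip inferInstance
  haveI : SurjectiveOnStalks j := MorphismProperty.of_isPullback Hgen.flip inferInstance
  -- `𝒴` is integral, separated, Noetherian, quasi-excellent, of dimension `≤ 3`
  haveI : IsIntegral g.image := Motives.isIntegral_image_of_isIntegral g
  haveI : g.image.IsSeparated := Scheme.isSeparated_of_isSeparated_over f
  haveI : IsNoetherianRing (CommRingCat.of O) := inferInstanceAs (IsNoetherianRing O)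
  haveI : IsNoetherian g.image := by
    haveI : IsLocallyNoetherian g.image := LocallyOfFiniteType.isLocallyNoetherian f
    haveI : CompactSpace g.image := QuasiCompact.compactSpace_of_compactSpace f
    exact {}
  have hqe : Scheme.IsQuasiExcellent g.image :=
    Scheme.isQuasiExcellent_of_locallyOfFiniteType_of_isQuasiExcellentRing Stacks07QU_holds
      ⟨hO.2.1, hO.2.2⟩ f
  have hdimY : topologicalKrullDim g.image ≤ (d + 1 : ℕ) :=
    topologicalKrullDim_le_of_genericFibre f S.hom j Hgen.w hdim
  have hd3 : ((d + 1 : ℕ) : WithBot ℕ∞) ≤ 3 := by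
    have : d + 1 ≤ 3 := by omega
    exact_mod_cast this
  -- Theorem 1.1: a good resolution `π : 𝒳 → 𝒴`
  obtain ⟨𝒳, π, hπ⟩ := h g.image hqe (hdimY.trans hd3)
  haveI : IsProper π := hπ.isResolution.isProper
  obtain ⟨U, hUreg, hUiso⟩ := hπ.isIso_restrict_regularLocus
  haveI := hUiso
  -- `S = 𝒴 ×_𝒪 F` lands in `Reg 𝒴` (the stalk maps of the flat, surjective-on-stalks `j` are
  -- isomorphisms and `S` is regular)
  have hrange : Set.range j ⊆ (U : Set g.image) := by
    rintro _ ⟨σ, rfl⟩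
    rw [hUreg, Scheme.mem_regularLocus]
    haveI := Motives.isIso_stalkMap_of_flat_of_surjectiveOnStalks j σ
    haveI := hreg σ
    exact IsRegularLocalRing.of_ringEquiv (asIso (j.stalkMap σ)).commRingCatIsoToRingEquiv.symm
  haveI hsnd : IsIso (pullback.snd π j) := isIso_pullback_snd_of_range_subset π U j hrange
  -- `𝒳` is integral: reduced (regular) and irreducible (`π⁻¹ V ≅ V` dense for a dense open `V`)
  haveI : IsReduced 𝒳 := hπ.isResolution.isRegular.isReduced
  obtain ⟨V, hVd, hVd', hViso⟩ := hπ.isResolution.isBirational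
  haveI := hViso
  haveI : Nonempty 𝒳 := by
    obtain ⟨σ⟩ := (inferInstance : Nonempty S.left)
    exact ⟨pullback.fst π j ((inv (pullback.snd π j)) σ)⟩
  have hVne : (V : Set g.image).Nonempty := hVd.nonempty
  haveI : Nonempty V := by obtain ⟨x, hx⟩ := hVne; exact ⟨⟨x, hx⟩⟩
  haveI : Nonempty ((π ⁻¹ᵁ V : 𝒳.Opens) : Scheme.{u}) := by
    obtain ⟨x, hx⟩ := hVd'.nonempty
    exact ⟨(⟨x, hx⟩ : (π ⁻¹ᵁ V : 𝒳.Opens))⟩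
  haveI : IsIntegral (V : Scheme.{u}) := inferInstance
  haveI : IsIntegral ((π ⁻¹ᵁ V : 𝒳.Opens) : Scheme.{u}) := isIntegral_of_isOpenImmersion (π ∣_ V)
  haveI : IrreducibleSpace 𝒳 := by
    rw [irreducibleSpace_def]
    have h1 : IsIrreducible ((π ⁻¹ᵁ V : 𝒳.Opens) : Set 𝒳) := by
      have := (IrreducibleSpace.isIrreducible_univ (π ⁻¹ᵁ V : Scheme.{u})).image
        (π ⁻¹ᵁ V).ι (π ⁻¹ᵁ V).ι.continuous.continuousOn
      rwa [Set.image_univ, Scheme.Opens.range_ι] at this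
    have h2 := h1.closure
    rwa [hVd'.closure_eq] at h2
  haveI : IsIntegral 𝒳 := isIntegral_of_irreducibleSpace_of_isReduced 𝒳
  -- `𝒳 → Spec 𝒪` is dominant, hence flat
  haveI : IsDominant (π ≫ f) := by
    obtain ⟨σ⟩ := (inferInstance : Nonempty S.left)
    refine isDominant_of_apply_eq_bot (π ≫ f) (pullback.fst π j ((inv (pullback.snd π j)) σ)) ?_
    have hc : ∀ p, π (pullback.fst π j p) = j (pullback.snd π j p) := fun p => by
      rw [← Scheme.Hom.comp_apply, pullback.condition, Scheme.Hom.comp_apply]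
    have hs : pullback.snd π j ((inv (pullback.snd π j)) σ) = σ := by
      rw [← Scheme.Hom.comp_apply, IsIso.inv_hom_id]; rfl
    have hw : f (j σ) = i (S.hom σ) := by
      rw [← Scheme.Hom.comp_apply, Hgen.w, Scheme.Hom.comp_apply]
    rw [Scheme.Hom.comp_apply, hc, hs, hw]
    exact specMap_algebraMap_apply_eq_bot F (S.hom σ)
  haveI : Flat (π ≫ f) := flat_of_isIntegral_of_isDominant (π ≫ f)
  -- the generic fibre `𝒳 ×_𝒪 F = 𝒳 ×_𝒴 S ≅ S`
  have Hbig : IsPullback (pullback.fst π j) (pullback.snd π j ≫ S.hom) (π ≫ f) i :=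
    (IsPullback.of_hasPullback π j).paste_vert Hgen
  let e1 : Over.mk (pullback.snd (π ≫ f) i) ≅ Over.mk (pullback.snd π j ≫ S.hom) :=
    (Over.isoMk Hbig.isoPullback Hbig.isoPullback_hom_snd :
      Over.mk (pullback.snd π j ≫ S.hom) ≅ Over.mk (pullback.snd (π ≫ f) i)).symm
  let e2 : Over.mk (pullback.snd π j ≫ S.hom) ≅ S :=
    Over.isoMk (@asIso _ _ _ _ (pullback.snd π j) hsnd) rfl
  exact ⟨𝒳, π ≫ f, inferInstance, inferInstance, hπ.isResolution.isRegular, ⟨e1 ≪≫ e2⟩⟩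

/-- **Cossart–Piltant 2019, Cor. 1.3 from Thm. 1.1** (printed proof: §4.1, arXiv:1412.0868v1
p. 52 — any projective model `𝒴` of `Σ`, generic flatness [EGA IV₂ (6.9.1), Publ. IHES 24] over some
`𝒰 ⊆ Spec 𝒪`, Thm. 1.1 applied to the closure of `s⁻¹(𝒰)`; formalised in the variant for an
integral `Σ = S`, where the scheme-theoretic closure of `S` in `ℙᴺ_𝒪` is integral, hence already
flat over the Dedekind base, and no generic flatness is used). Given the tree's
transcription `CossartPiltant2019Thm11` of Theorem 1.1, every regular integral projective surface
`S` over the fraction field `F` of an excellent Dedekind domain `𝒪` has a proper flat regular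
model over `𝒪` with generic fibre `S`: the scheme-theoretic closure `𝒴` of `S ⊆ ℙᴺ_F` in `ℙᴺ_𝒪`
is an integral, separated, Noetherian, quasi-excellent (`Resolution.Stacks07QU_holds`) scheme of
dimension `≤ 3` (`topologicalKrullDim_le_of_genericFibre`) with generic fibre `S`
(`Motives.isPullback_toImage_of_flat_mono`); Theorem 1.1 resolves it by `π : 𝒳 → 𝒴`, an
isomorphism over `Reg 𝒴 ⊇ S`; `𝒳 → Spec 𝒪` is proper, flat (`flat_of_isIntegral_of_isDominant`)
and regular with generic fibre `𝒳 ×_𝒪 F = 𝒳 ×_𝒴 (𝒴 ×_𝒪 F) = 𝒳 ×_𝒴 S ≅ S`.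
[cite: CossartPiltant2019, Cor. 1.3 (statement §1, arXiv:1412.0868v1 p. 3; proof §4.1, p. 52)] -/
theorem cor13_of_thm11 (h : CossartPiltant2019Thm11.{u}) : CossartPiltant2019Cor13.{u} := by
  intro O _ _ hO F _ _ _ S hS hint hreg hdim
  haveI := hint
  exact exists_regularModel_of_thm11 h O hO F S hS hreg hdim le_rfl

end Cor13

end Literature.AlgebraicGeometry.CossartPiltant200819.CP2019
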